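import Summits.QuantumFields.YangMills.Theorems.SwapVirialDeficitSectorStiffnessOfRegions
import Summits.QuantumFields.YangMills.Theorems.SwapVirialDeficitBlowUpVirialRing
import HarnessLib

/-!
# (S)-road ➎: THE CHART MEASURE `cone ⊗ ρdη` — integral identities and `(TS)_000` from per-sign-pattern chart stiffness
# (free-hands support of ⟨stmt-QuantumFields-24197⟩ `SwapVirialDeficit.SwapGluedStiffness`; cell ym-idea-1, LEAD g98 18:47Z∕18:55Z∕18:57Z, assembler fcl-p3 g47)

LEAD g98's ruling ➎ («localize the two-sided law», memo5): the sector stiffness `(TS)_z : κ·∫e^{−βF_z}dμ_L ≤ β·∫F_z e^{−βF_z}dμ_L` of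
✓`swapGluedStiffness_of_twoSectorStiffness` is ADDITIVE in the measure, hence a sum of per-REGION inequalities obtained from ✓`stiffness_of_regions[_and_core]` ∕
✓`stiffness_of_local_twoSided_laws` (✓`SwapVirialDeficitLocalTwoSidedStiffness`) on a finite measure space.  LEAD 18:55Z asked for that measure space in the tree:
here it is, ONE SIGN PATTERN AT A TIME (the regions of ➎ are defined by leader angles inside each sign chart, so no counting-measure factor is needed):
`chartMeasure L = coneMeasure ⊗ fibreMeasure L`, `fibreMeasure L = ρ(η)dη` (✓`SectorLaplaceDefs` §6), with `F := F̂_{z₀,ε}(a,η)` (✓`measurable_gnoDeficit_uncurry`, bounded,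
`≥ 0`).

* §1 `isFiniteMeasure_fibreMeasure` ∕ `isFiniteMeasure_chartMeasure`, `integral_fibreMeasure` (`∫g d(ρdη) = ∫gρ`), `integrable_chartMeasure_of_bounded`, ★ `integral_chartMeasure`
  (`∫f d(chartMeasure) = ∫_cone∫ f(a,η)ρ(η)dη da`), `setIntegral_chartMeasure`, `ae_hub_re_im_ne_zero_chartMeasure`;
* §2 ★★ `sector_integral_eq_chartMeasure` — `∫ g(F^S_000) dμ_L = K_L·Σ_ε ∫ g(F̂_{a,ε}(η)) d(chartMeasure)` for measurable `g` bounded along `F` (✓`integral_ringMeasure_eq_gnomonic`);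
  the two instances `sector_exp_eq_chartMeasure`, `sector_action_eq_chartMeasure`;
* §3 ★★★ `sectorStiffness_of_chartStiffness` — for `b > 0` and any `κ`: the chart stiffness `κ·∫e^{−bF̂_ε}d(chartMeasure) ≤ b·∫F̂_ε e^{−bF̂_ε}d(chartMeasure)` for every GOOD
  sign pattern (the output of LEAD's lemmas with `μ := chartMeasure L`, `F := F̂_ε`) + the pointwise floor `κ ≤ bF̂` for the BAD ones (✓`badSign_floor`: the «rest» of ➎ is exactly
  the bad-sign set, LEAD 18:57Z (1)) ⟹ `(TS)_000` at this `b`: `κ·∫e^{−bF₀}dμ_L ≤ b·∫F₀e^{−bF₀}dμ_L`.  Feeding ✓`twoSectorStiffness_of_windows` ∕ ✓`swapGluedStiffness_of_windows`.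

HONEST LABEL: measure-theoretic glue; every region inequality of ➎ is OPEN ((Ra) fcl-p3 g47 on w2's `bulk_fibred_plane`; (Rb)(Rd) w3 g66; (Rc) w2 g59 + w3; 001 w3's charts);
⟨24197⟩ ∕ ⟨24194⟩ OPEN; ⟨24196⟩ proved elsewhere; item of record ⟨24085⟩ SubOctaveBounded aside ∕ untouched; the Yang–Mills mass gap is NOT proved; no summit is proved by
a line.  THEOREMS ONLY (0 `def`, 0 `sorry`), standard axioms; the `attribute [local instance]` block is the chart's measurable structure on `ℍ` (as in ✓`SectorLaplaceDefs`;
nothing overridden).  Seat ym-line-fcl-p3 g47 (cell ym-idea-1, free hands), `--supports stmt-QuantumFields-24197`.  References: [cite: Luscher1983, §2]; [cite: tHooft1979]; [folklore].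
-/

set_option autoImplicit false
set_option synthInstance.maxSize 1024

noncomputable section

open MeasureTheory Quaternion Set
open scoped Quaternion BigOperators ENNReal
open Literature.MathematicalPhysics.QuantumLattice
open Literature.MathematicalPhysics.QuantumFieldTheory hiding SU2
open Summit.QuantumFields.YangMills.Theorems.SwapTwistDeficit.ToronLog

attribute [local instance] Literature.Analysis.FluidPDE.Tao2016.quatMeasurableSpace
  Literature.Analysis.FluidPDE.Tao2016.quatBorelSpace
  Literature.MathematicalPhysics.QuantumLattice.secondCountableTopology_su2

namespace Summit.QuantumFields.YangMills.Theorems.SwapVirialDeficit.SectorLaplace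

open Summit.QuantumFields.YangMills.Theorems.FemtoTransferGap
open Summit.QuantumFields.YangMills.Theorems.FemtoTransferGap.TT
open Summit.QuantumFields.YangMills.Theorems.VirialFluxGap.RingDeficit
open Summit.QuantumFields.YangMills.Theorems.SwapVirialDeficit.SwapRing
open Summit.QuantumFields.YangMills.Theorems.SwapVirialDeficit.BlowUpRing

variable {L : ℕ} [NeZero L]

/-! ## §1 The chart measure: finiteness and iterated integrals -/

/-- `ρ(η)dη` is a finite measure (`∫ρ < ∞`, ✓`integrable_gnoDensity`). [folklore] -/
theorem isFiniteMeasure_fibreMeasure : IsFiniteMeasure (fibreMeasure L) := by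
  unfold fibreMeasure
  exact isFiniteMeasure_withDensity_ofReal (integrable_gnoDensity (L := L)).hasFiniteIntegral

/-- `cone ⊗ ρdη` is a finite measure. [folklore] -/
theorem isFiniteMeasure_chartMeasure : IsFiniteMeasure (chartMeasure L) := by
  haveI := isProbabilityMeasure_coneMeasure
  haveI := isFiniteMeasure_fibreMeasure (L := L)
  unfold chartMeasure
  infer_instance

/-- `∫ g d(ρdη) = ∫ g·ρ dη` (every `g`; both sides carry the same Bochner junk value). [folklore] -/
theorem integral_fibreMeasure (g : GnoCoord L → ℝ) : ∫ η, g η ∂fibreMeasure L = ∫ η, g η * gnoDensity η := by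
  unfold fibreMeasure
  rw [integral_withDensity_eq_integral_toReal_smul measurable_gnoDensity.ennreal_ofReal
    (Filter.Eventually.of_forall fun _ => ENNReal.ofReal_lt_top)]
  refine integral_congr_ae (Filter.Eventually.of_forall fun η => ?_)
  show (ENNReal.ofReal (gnoDensity η)).toReal • g η = g η * gnoDensity η
  rw [ENNReal.toReal_ofReal (gnoDensity_pos η).le, smul_eq_mul, mul_comm]

/-- A bounded measurable function is integrable for the chart measure. [folklore] -/
theorem integrable_chartMeasure_of_bounded {f : ℍ × GnoCoord L → ℝ} (hf : Measurable f) {M : ℝ} (hbd : ∀ x, |f x| ≤ M) :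
    Integrable f (chartMeasure L) := by
  haveI := isFiniteMeasure_chartMeasure (L := L)
  exact (integrable_const M).mono' hf.aestronglyMeasurable (Filter.Eventually.of_forall fun x => by rw [Real.norm_eq_abs]; exact hbd x)

/-- ★ THE ITERATED FORM: `∫ f d(chartMeasure) = ∫_cone (∫ f(a,η)·ρ(η) dη) da` for integrable `f`. [folklore] -/
theorem integral_chartMeasure {f : ℍ × GnoCoord L → ℝ} (hf : Integrable f (chartMeasure L)) :
    ∫ x, f x ∂chartMeasure L = ∫ a, (∫ η, f (a, η) * gnoDensity η) ∂coneMeasure := by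
  haveI := isProbabilityMeasure_coneMeasure
  haveI := isFiniteMeasure_fibreMeasure (L := L)
  have hf' : Integrable f (coneMeasure.prod (fibreMeasure L)) := hf
  have h := integral_prod f hf'
  have e : chartMeasure L = coneMeasure.prod (fibreMeasure L) := rfl
  rw [e, h]
  exact integral_congr_ae (Filter.Eventually.of_forall fun a => integral_fibreMeasure _)

/-- The iterated form on a measurable region `R`. [folklore] -/
theorem setIntegral_chartMeasure {f : ℍ × GnoCoord L → ℝ} (hf : Integrable f (chartMeasure L)) {R : Set (ℍ × GnoCoord L)}
    (hR : MeasurableSet R) :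
    ∫ x in R, f x ∂chartMeasure L = ∫ a, (∫ η, R.indicator f (a, η) * gnoDensity η) ∂coneMeasure := by
  rw [← integral_indicator hR]
  exact integral_chartMeasure (hf.indicator hR)

/-- Chart-a.e. the hub has `re a ≠ 0` and `im a ≠ 0` (✓`ae_re_ne_zero_im_ne_zero_coneMeasure` on the first factor). [folklore] -/
theorem ae_hub_re_im_ne_zero_chartMeasure : ∀ᵐ x : ℍ × GnoCoord L ∂chartMeasure L, x.1.re ≠ 0 ∧ x.1.im ≠ 0 := by
  haveI := isProbabilityMeasure_coneMeasure
  haveI := isFiniteMeasure_fibreMeasure (L := L)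
  have h : Measure.QuasiMeasurePreserving (Prod.fst : ℍ × GnoCoord L → ℍ) (chartMeasure L) coneMeasure :=
    Measure.quasiMeasurePreserving_fst
  exact h.ae ae_re_ne_zero_im_ne_zero_coneMeasure

/-! ## §2 The ring integral in the chart measure -/

/-- `a ↦ ∫ f(a,η)ρ(η)dη` is cone-integrable for bounded jointly measurable `f`. [folklore] -/
theorem integrable_fibreIntegral_of_bounded {f : ℍ × GnoCoord L → ℝ} (hf : Measurable f) {M : ℝ} (hbd : ∀ x, |f x| ≤ M) :
    Integrable (fun a : ℍ => ∫ η, f (a, η) * gnoDensity η) coneMeasure := by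
  haveI := isProbabilityMeasure_coneMeasure
  have hsm : StronglyMeasurable fun a : ℍ => ∫ η, f (a, η) * gnoDensity η := by
    have h := (hf.mul (measurable_gnoDensity.comp measurable_snd)).stronglyMeasurable.integral_prod_right' (ν := (volume : Measure (GnoCoord L)))
    exact h
  refine (integrable_const (M * ∫ η : GnoCoord L, gnoDensity η)).mono' hsm.aestronglyMeasurable (Filter.Eventually.of_forall fun a => ?_)
  rw [Real.norm_eq_abs, ← integral_const_mul]
  refine (abs_integral_le_integral_abs).trans (integral_mono_of_nonneg (Filter.Eventually.of_forall fun η => abs_nonneg _)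
    (integrable_gnoDensity.const_mul M) (Filter.Eventually.of_forall fun η => ?_))
  show |f (a, η) * gnoDensity η| ≤ M * gnoDensity η
  rw [abs_mul, abs_of_pos (gnoDensity_pos η)]
  exact mul_le_mul_of_nonneg_right (hbd _) (gnoDensity_pos η).le

set_option maxHeartbeats 400000 in
/-- ★★ **THE RING INTEGRAL IN THE CHART MEASURE**: for measurable `g` bounded along the deficit, `∫ g(F^S_000(P)) dμ_L(P) = K_L·Σ_ε ∫ g(F̂_{a,ε}(η)) d(chartMeasure)(a,η)`
(✓`integral_ringMeasure_eq_gnomonic` with the seam-invariant integrand `g ∘ F^S`, then Fubini per sign pattern). [cite: tHooft1979] -/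
theorem sector_integral_eq_chartMeasure {g : ℝ → ℝ} (hg : Measurable g) {M : ℝ}
    (hbd : ∀ P : (Fin (2 * L - 1 + 1) → GaugeConfig 3 L SU2) × (Site 3 L → SU2), |g (swapRingDeficit L z₀ P)| ≤ M) :
    ∫ P, g (swapRingDeficit L z₀ P) ∂(ringMeasure L) =
      KL L * ∑ ε : GnoSign L, ∫ x, g (gnoDeficit z₀ (fun _ => 1) x.1 ε x.2) ∂chartMeasure L := by
  have h := integral_ringMeasure_eq_gnomonic (L := L) (⇑(sitePerm (L := L) (Equiv.swap (0 : Fin 3) 1))) (χ := fun _ => 1) one_central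
    (G := fun p => g (swapRingDeficit L z₀ p)) (hg.comp (measurable_swapRingDeficit z₀)) (M := M) (fun p => hbd p)
    (fun h p => by simp only [swapRingDeficit_seamGaugeAct])
  rw [h]
  show KL L * ∫ a, (∑ ε : GnoSign L, ∫ η : GnoCoord L, g (gnoDeficit z₀ (fun _ => 1) a ε η) * gnoDensity η) ∂coneMeasure = _
  have hbd' : ∀ (ε : GnoSign L) (x : ℍ × GnoCoord L), |g (gnoDeficit z₀ (fun _ => 1) x.1 ε x.2)| ≤ M := fun ε x => hbd _
  have hmeas : ∀ ε : GnoSign L, Measurable fun x : ℍ × GnoCoord L => g (gnoDeficit z₀ (fun _ => 1) x.1 ε x.2) :=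
    fun ε => hg.comp (measurable_gnoDeficit_uncurry z₀ (fun _ => 1) ε)
  have hint : ∀ ε : GnoSign L, Integrable (fun a : ℍ => ∫ η : GnoCoord L, g (gnoDeficit z₀ (fun _ => 1) a ε η) * gnoDensity η) coneMeasure :=
    fun ε => integrable_fibreIntegral_of_bounded (hmeas ε) (hbd' ε)
  rw [integral_finsetSum _ fun ε _ => hint ε]
  refine congrArg (fun t => KL L * t) (Finset.sum_congr rfl fun ε _ => ?_)
  exact (integral_chartMeasure (integrable_chartMeasure_of_bounded (hmeas ε) (hbd' ε))).symm

/-- ★ `Z₀(b) = K_L·Σ_ε ∫ e^{−bF̂_ε} d(chartMeasure)` (`b ≥ 0`). [cite: tHooft1979] -/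
theorem sector_exp_eq_chartMeasure {b : ℝ} (hb : 0 ≤ b) :
    ∫ P, Real.exp (-(b * swapRingDeficit L z₀ P)) ∂(ringMeasure L) =
      KL L * ∑ ε : GnoSign L, ∫ x, Real.exp (-(b * gnoDeficit z₀ (fun _ => 1) x.1 ε x.2)) ∂chartMeasure L :=
  sector_integral_eq_chartMeasure (g := fun t => Real.exp (-(b * t))) (Real.measurable_exp.comp ((measurable_id.const_mul b).neg)) (M := 1)
    fun P => by
      rw [abs_of_pos (Real.exp_pos _)]
      exact Real.exp_le_one_iff.2 (by have := swapRingDeficit_nonneg (L := L) z₀ P; nlinarith)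

/-- ★ `E₀(b) = ∫F e^{−bF} dμ_L = K_L·Σ_ε ∫ F̂_ε e^{−bF̂_ε} d(chartMeasure)` (`b ≥ 0`). [cite: tHooft1979] -/
theorem sector_action_eq_chartMeasure {b : ℝ} (hb : 0 ≤ b) :
    ∫ P, swapRingDeficit L z₀ P * Real.exp (-(b * swapRingDeficit L z₀ P)) ∂(ringMeasure L) =
      KL L * ∑ ε : GnoSign L, ∫ x, gnoDeficit z₀ (fun _ => 1) x.1 ε x.2 * Real.exp (-(b * gnoDeficit z₀ (fun _ => 1) x.1 ε x.2)) ∂chartMeasure L := by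
  obtain ⟨B, hB⟩ := exists_abs_swapRingDeficit_le (L := L) z₀
  exact sector_integral_eq_chartMeasure (g := fun t => t * Real.exp (-(b * t)))
    (measurable_id.mul (Real.measurable_exp.comp ((measurable_id.const_mul b).neg))) (M := B) fun P => by
      rw [abs_mul, abs_of_pos (Real.exp_pos _)]
      have h1 : Real.exp (-(b * swapRingDeficit L z₀ P)) ≤ 1 :=
        Real.exp_le_one_iff.2 (by have := swapRingDeficit_nonneg (L := L) z₀ P; nlinarith)
      calc |swapRingDeficit L z₀ P| * Real.exp (-(b * swapRingDeficit L z₀ P)) ≤ B * 1 :=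
          mul_le_mul (hB P) h1 (Real.exp_pos _).le ((abs_nonneg _).trans (hB P))
        _ = B := mul_one B

/-! ## §3 `(TS)_000` from per-sign-pattern chart stiffness -/

set_option maxHeartbeats 400000 in
/-- ★★★ **`(TS)_000` AT FIXED `L`, `b > 0`, FROM CHART STIFFNESS PER SIGN PATTERN**: if for every GOOD sign pattern `ε` the chart-measure stiffness
`κ·∫e^{−bF̂_ε}d(chartMeasure) ≤ b·∫F̂_ε e^{−bF̂_ε}d(chartMeasure)` holds (the output of ✓`stiffness_of_regions_and_core` ∕ ✓`stiffness_of_local_twoSided_laws` with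
`μ := chartMeasure L`, `F := F̂_ε`), and for the BAD patterns `κ ≤ b·F̂_{a,ε}(η)` pointwise at every hub `a ≠ 0` (✓`badSign_floor` above a polynomial threshold), then
`κ·∫e^{−bF₀}dμ_L ≤ b·∫F₀e^{−bF₀}dμ_L`. [cite: Luscher1983, §2] -/
theorem sectorStiffness_of_chartStiffness {κ b : ℝ} (hb : 0 < b)
    (hgood : ∀ ε : GnoSign L, GoodSign ε →
      κ * ∫ x, Real.exp (-b * gnoDeficit z₀ (fun _ => 1) x.1 ε x.2) ∂chartMeasure L ≤
        b * ∫ x, gnoDeficit z₀ (fun _ => 1) x.1 ε x.2 * Real.exp (-b * gnoDeficit z₀ (fun _ => 1) x.1 ε x.2) ∂chartMeasure L)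
    (hbad : ∀ a : ℍ, a ≠ 0 → ∀ ε : GnoSign L, ¬ GoodSign ε → ∀ η : GnoCoord L, κ ≤ b * gnoDeficit z₀ (fun _ => 1) a ε η) :
    κ * ∫ P, Real.exp (-(b * swapRingDeficit L z₀ P)) ∂(ringMeasure L) ≤
      b * ∫ P, swapRingDeficit L z₀ P * Real.exp (-(b * swapRingDeficit L z₀ P)) ∂(ringMeasure L) := by
  haveI := isFiniteMeasure_chartMeasure (L := L)
  rw [sector_exp_eq_chartMeasure hb.le, sector_action_eq_chartMeasure hb.le]
  -- per sign pattern: `κ·Z_ε ≤ b·E_ε` on the chart measure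
  have hper : ∀ ε : GnoSign L, κ * ∫ x, Real.exp (-(b * gnoDeficit z₀ (fun _ => 1) x.1 ε x.2)) ∂chartMeasure L ≤
      b * ∫ x, gnoDeficit z₀ (fun _ => 1) x.1 ε x.2 * Real.exp (-(b * gnoDeficit z₀ (fun _ => 1) x.1 ε x.2)) ∂chartMeasure L := by
    intro ε
    by_cases hε : GoodSign ε
    · have h := hgood ε hε
      simp only [neg_mul] at h
      exact h
    · -- bad pattern: pointwise at chart-a.e. point (`a ≠ 0`)
      have hF : Measurable fun x : ℍ × GnoCoord L => gnoDeficit z₀ (fun _ => 1) x.1 ε x.2 := measurable_gnoDeficit_uncurry z₀ (fun _ => 1) ε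
      obtain ⟨B, hB0, hB⟩ := exists_abs_gnoDeficit_le (L := L)
      have hZi : Integrable (fun x : ℍ × GnoCoord L => Real.exp (-(b * gnoDeficit z₀ (fun _ => 1) x.1 ε x.2))) (chartMeasure L) :=
        integrable_chartMeasure_of_bounded ((hF.const_mul b).neg.exp) (M := 1) fun x => by
          rw [abs_of_pos (Real.exp_pos _)]
          exact Real.exp_le_one_iff.2 (by have := gnoDeficit_nonneg z₀ (fun _ => (1 : SU2)) x.1 ε x.2; nlinarith)
      have hEi : Integrable (fun x : ℍ × GnoCoord L => gnoDeficit z₀ (fun _ => 1) x.1 ε x.2 * Real.exp (-(b * gnoDeficit z₀ (fun _ => 1) x.1 ε x.2)))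
          (chartMeasure L) :=
        integrable_chartMeasure_of_bounded (hF.mul (hF.const_mul b).neg.exp) (M := B) fun x => by
          rw [abs_mul, abs_of_pos (Real.exp_pos _)]
          have h1 : Real.exp (-(b * gnoDeficit z₀ (fun _ => 1) x.1 ε x.2)) ≤ 1 :=
            Real.exp_le_one_iff.2 (by have := gnoDeficit_nonneg z₀ (fun _ => (1 : SU2)) x.1 ε x.2; nlinarith)
          calc |gnoDeficit z₀ (fun _ => 1) x.1 ε x.2| * Real.exp (-(b * gnoDeficit z₀ (fun _ => 1) x.1 ε x.2)) ≤ B * 1 :=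
              mul_le_mul (hB x.1 ε x.2) h1 (Real.exp_pos _).le hB0
            _ = B := mul_one B
      rw [← integral_const_mul, ← integral_const_mul]
      refine integral_mono_ae (hZi.const_mul κ) (hEi.const_mul b) ?_
      refine (ae_hub_re_im_ne_zero_chartMeasure (L := L)).mono fun x hx => ?_
      have ha : x.1 ≠ 0 := fun h0 => hx.1 (by rw [h0]; rfl)
      have hpt := hbad x.1 ha ε hε x.2
      have he : 0 ≤ Real.exp (-(b * gnoDeficit z₀ (fun _ => 1) x.1 ε x.2)) := (Real.exp_pos _).le
      calc κ * Real.exp (-(b * gnoDeficit z₀ (fun _ => 1) x.1 ε x.2))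
          ≤ (b * gnoDeficit z₀ (fun _ => 1) x.1 ε x.2) * Real.exp (-(b * gnoDeficit z₀ (fun _ => 1) x.1 ε x.2)) := mul_le_mul_of_nonneg_right hpt he
        _ = b * (gnoDeficit z₀ (fun _ => 1) x.1 ε x.2 * Real.exp (-(b * gnoDeficit z₀ (fun _ => 1) x.1 ε x.2))) := by ring
  -- sum over the sign patterns and multiply by `K_L ≥ 0`
  have hKL : 0 ≤ KL L := KL_nonneg
  have hsum := Finset.sum_le_sum fun ε (_ : ε ∈ (Finset.univ : Finset (GnoSign L))) => hper ε
  rw [← Finset.mul_sum, ← Finset.mul_sum] at hsum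
  calc κ * (KL L * ∑ ε : GnoSign L, ∫ x, Real.exp (-(b * gnoDeficit z₀ (fun _ => 1) x.1 ε x.2)) ∂chartMeasure L)
      = KL L * (κ * ∑ ε : GnoSign L, ∫ x, Real.exp (-(b * gnoDeficit z₀ (fun _ => 1) x.1 ε x.2)) ∂chartMeasure L) := by ring
    _ ≤ KL L * (b * ∑ ε : GnoSign L, ∫ x, gnoDeficit z₀ (fun _ => 1) x.1 ε x.2 * Real.exp (-(b * gnoDeficit z₀ (fun _ => 1) x.1 ε x.2)) ∂chartMeasure L) :=
        mul_le_mul_of_nonneg_left hsum hKL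
    _ = b * (KL L * ∑ ε : GnoSign L, ∫ x, gnoDeficit z₀ (fun _ => 1) x.1 ε x.2 * Real.exp (-(b * gnoDeficit z₀ (fun _ => 1) x.1 ε x.2)) ∂chartMeasure L) := by
        ring

end Summit.QuantumFields.YangMills.Theorems.SwapVirialDeficit.SectorLaplace

end
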